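import Literature.AlgebraicGeometry.HodgeTheory.FermatSurfaceHodgeCharacterEightDvd
import Literature.AlgebraicGeometry.Shioda1982.StandardQuadrupleLetter
import HarnessLib

/-!
# Theorem C at the levels `m` with `8 ∣ m`, `3 ∤ m` and a good prime: standard quadruples and the letter of `(𝔅²ₘ)` (ii)

Topic `Literature/AlgebraicGeometry/Shioda1982`. THEOREMS only (no definition, no named fact, no `sorry`).

`HodgeTheory/FermatSurfaceHodgeCharacterEightDvd` proves [Aoki1983, Thm. C] at the levels `m` with `8 ∣ m`, `3 ∤ m`
and a good prime (`p ∣ m` with `p ≥ 11`, or `p ∈ {5, 7}` with `p² ∣ m`), in function form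
(`standard_of_isHodge_eight_dvd`: a primitive Hodge character of length `4` is decomposable, of type A
`(x, -2x, x + m/2, m/2)`, or of type B `(x, 2x + m/2, x + m/2, -4x)`). This file rewrites that in the two other
vocabularies of the tree (as `StandardQuadrupleTwiceCoprime`, `StandardQuadrupleFourTimesCoprime` do at `m = 2m'`,
`4m'`):
* **`isStandardQuadruple_of_eight_dvd`**: the multiset of values of a pair-free primitive Hodge character is a
  standard quadruple `t·L₁` or `t·L₂` of [MeyerNeutsch1981Fermatquadrupel, (13)–(14) p. 53] (`IsStandardQuadruple`,
  `ExceptionalQuadruples.lean`), `K = m/2`;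
* **`forall_dvd_of_isPrimitive_of_even`**: at an even level, Meyer–Neutsch primitivity of the value multiset of a
  Hodge character gives `GCD(aᵢ) = 1`;
* **`not_isExceptionalQuadruple_eight_dvd`**: `Δ(m) = 0` — no Ausnahmequadrupel at these levels (the multiset form, the
  shape of the kernel sweeps `not_isExceptionalQuadruple_N`);
* **`thmB2m_standard_eight_dvd`**: the letter of the tree's named fact `AokiShioda1983_thmB2m_standard`
  (`HodgeTheory/FermatSurfaceHodgeCharacterStructure`) at these levels: every indecomposable primitive Hodge character
  is a permutation of `αᵢ = (i, d+i, −2i, d)` or `βᵢ = (i, d+i, d+2i, −4i)`, `d = m/2` (via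
  `letter_of_isStandardQuadruple`, `StandardQuadrupleLetter.lean`).
The companion `PicardNumberTwoPowerPrime.lean` treats `m = 2ᵏp` by the kernel route.

HONEST FRAMING (cell `pub-hfermat`): explicit algebraic cycles for specific Hodge classes on Fermat/Delsarte varieties;
residual open instances listed; no claim on general Hodge. (Surface classes are algebraic by Lefschetz (1,1); this file
restates a proved case of a structure theorem for `𝔅²ₘ`.)

## References
* [Aoki1983] N. Aoki, Math. Ann. 266 (1983) 23–54, Thm. C and §9.
* [AokiShioda1983] N. Aoki, T. Shioda, Progr. Math. 35 (1983) 1–12, §2 Thm (𝔅²ₘ) (ii) a), b).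
* [MeyerNeutsch1981Fermatquadrupel] W. Meyer, W. Neutsch, Math. Ann. 256 (1981) 51–62, (13)–(14) p. 53, Tabelle 1 p. 54.
-/

namespace Literature.AlgebraicGeometry.Shioda1982

open Finset Multiset Literature.AlgebraicGeometry.HodgeTheory Literature.AlgebraicGeometry.HodgeTheory.FermatCharacter

section EightDvd

variable {m : ℕ} [NeZero m]

omit [NeZero m] in
/-- The multiset of values of a `4`-tuple, listed along four pairwise distinct indices. [folklore] -/
private theorem univ_val_map_eq_of_distinct₈ {X : Type*} (α : Fin 4 → X) (a b c d : Fin 4) (hab : a ≠ b)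
    (hac : a ≠ c) (had : a ≠ d) (hbc : b ≠ c) (hbd : b ≠ d) (hcd : c ≠ d) :
    univ.val.map α = {α a, α b, α c, α d} := by
  classical
  have hc4 : #({a, b, c, d} : Finset (Fin 4)) = 4 := by
    rw [Finset.card_insert_of_notMem (by simp [hab, hac, had]),
      Finset.card_insert_of_notMem (by simp [hbc, hbd]), Finset.card_pair hcd]
  have huniv : (univ : Finset (Fin 4)) = {a, b, c, d} :=
    (Finset.eq_univ_of_card _ (by rw [hc4]; simp)).symm
  rw [huniv, Finset.insert_val, Multiset.ndinsert_of_notMem (by simp [hab, hac, had]), Finset.insert_val,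
    Multiset.ndinsert_of_notMem (by simp [hbc, hbd]), Finset.insert_val,
    Multiset.ndinsert_of_notMem (by simp [hcd]), Finset.singleton_val]
  simp only [Multiset.insert_eq_cons, Multiset.map_cons, Multiset.map_singleton]

/-- **No exceptional quadruple at the levels `m` with `8 ∣ m`, `3 ∤ m` and a good prime:** the multiset of values of a
pair-free primitive Hodge character of length `4` is a standard quadruple — a unit multiple of `L₁ = (1, K, K+1, 2K−2)`
(type A, `t = x`) or of `L₂ = (1, K+1, K+2, 2K−4)` (type B), `K = m/2` (`standard_of_isHodge_eight_dvd`; `x·K = K` for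
the odd unit `x`). [cite: Aoki1983, Thm. C] [cite: MeyerNeutsch1981Fermatquadrupel, (13)–(14) p. 53 (Standardquadrupel)] -/
theorem isStandardQuadruple_of_eight_dvd (h8 : 8 ∣ m) (hm3 : ¬ 3 ∣ m) {p : ℕ} (hp : p.Prime) (hpm : p ∣ m)
    (hbig : 11 ≤ p ∨ (5 ≤ p ∧ p ^ 2 ∣ m)) {α : Fin 4 → ZMod m} (hα : IsHodge α)
    (hind : ∀ i j : Fin 4, i ≠ j → α i + α j ≠ 0) (hprim : ∀ g : ℕ, (∀ i, g ∣ (α i).val) → g = 1) :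
    IsStandardQuadruple m (univ.val.map α) := by
  classical
  have h2 : 2 ∣ m := dvd_trans (by norm_num) h8
  have hHH : ((m / 2 : ℕ) : ZMod m) + ((m / 2 : ℕ) : ZMod m) = 0 := by
    rw [← Nat.cast_add, ZMod.natCast_eq_zero_iff, ← two_mul, Nat.mul_div_cancel' h2]
  rcases standard_of_isHodge_eight_dvd h8 hm3 hp hpm hbig hα hprim with
    ⟨i, j, hij, h⟩ | ⟨i₀, j₁, j₂, j₃, h01, h02, h03, h12, h13, h23, hu, e1, e2, e3⟩ |
    ⟨i₀, j₁, j₂, j₃, h01, h02, h03, h12, h13, h23, hu, e1, e2, e3⟩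
  · exact absurd h (hind i j hij)
  · -- type A: `{x, -2x, x + m/2, m/2} = x · L₁`
    have hxH : (α i₀) * ((m / 2 : ℕ) : ZMod m) = ((m / 2 : ℕ) : ZMod m) := by
      have := half_mul_unit h2 hu.unit
      rw [IsUnit.unit_spec] at this
      rw [mul_comm (α i₀)]
      exact this
    refine ⟨hu.unit, Or.inl ⟨h2, Or.inl ?_⟩⟩
    rw [univ_val_map_eq_of_distinct₈ α i₀ j₁ j₂ j₃ h01 h02 h03 h12 h13 h23, e1, e2, e3, stdOne]
    simp only [Multiset.insert_eq_cons, Multiset.map_cons, Multiset.map_singleton, IsUnit.unit_spec, mul_one]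
    rw [show α i₀ * (((m / 2 : ℕ) : ZMod m) + 1) = α i₀ + ((m / 2 : ℕ) : ZMod m) by
        rw [mul_add, hxH, mul_one, add_comm],
      show α i₀ * (2 * ((m / 2 : ℕ) : ZMod m) - 2) = -2 * α i₀ by linear_combination (α i₀) * hHH, hxH]
    simp only [← Multiset.singleton_add]
    abel
  · -- type B: `{x, 2x + m/2, x + m/2, -4x} = x · L₂`
    have hxH : (α i₀) * ((m / 2 : ℕ) : ZMod m) = ((m / 2 : ℕ) : ZMod m) := by
      have := half_mul_unit h2 hu.unit
      rw [IsUnit.unit_spec] at this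
      rw [mul_comm (α i₀)]
      exact this
    refine ⟨hu.unit, Or.inl ⟨h2, Or.inr ?_⟩⟩
    rw [univ_val_map_eq_of_distinct₈ α i₀ j₁ j₂ j₃ h01 h02 h03 h12 h13 h23, e1, e2, e3, stdTwo]
    simp only [Multiset.insert_eq_cons, Multiset.map_cons, Multiset.map_singleton, IsUnit.unit_spec, mul_one]
    rw [show α i₀ * (((m / 2 : ℕ) : ZMod m) + 1) = α i₀ + ((m / 2 : ℕ) : ZMod m) by
        rw [mul_add, hxH, mul_one, add_comm],
      show α i₀ * (((m / 2 : ℕ) : ZMod m) + 2) = 2 * α i₀ + ((m / 2 : ℕ) : ZMod m) by rw [mul_add, hxH]; ring,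
      show α i₀ * (2 * ((m / 2 : ℕ) : ZMod m) - 4) = -4 * α i₀ by linear_combination (α i₀) * hHH]
    simp only [← Multiset.singleton_add]
    abel

/-! ### The multiset form: no exceptional quadruple at these levels -/

omit [NeZero m] in
/-- Divisibility of Meyer–Neutsch's `gcd(a₁, …, a_k, m)` (a right fold of `Nat.gcd`). [folklore] -/
private theorem dvd_foldr_gcd₈ {d b : ℕ} {l : Multiset ℕ} (hb : d ∣ b) (hl : ∀ v ∈ l, d ∣ v) :
    d ∣ l.foldr Nat.gcd b := by
  induction l using Multiset.induction_on with
  | empty => simpa using hb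
  | cons a l ih =>
    rw [Multiset.foldr_cons]
    exact Nat.dvd_gcd (hl a (Multiset.mem_cons_self a l)) (ih fun v hv ↦ hl v (Multiset.mem_cons_of_mem hv))

omit [NeZero m] in
/-- A `4`-tuple whose multiset of values has no pair `a, -a` (as two members) is indecomposable. [folklore] -/
private theorem indecomposable_of_not_hasPair₈ {α : Fin 4 → ZMod m} (h : ¬ HasPair (univ.val.map α)) :
    ∀ i j : Fin 4, i ≠ j → α i + α j ≠ 0 := by
  classical
  intro i j hij hsum
  apply h
  refine ⟨α i, Multiset.mem_map.mpr ⟨i, Finset.mem_univ_val i, rfl⟩, ?_⟩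
  have hneg : -α i = α j := by linear_combination (-1 : ZMod m) * hsum
  rw [hneg]
  by_cases he : α j = α i
  · have h2 : 2 ≤ Multiset.count (α i) (univ.val.map α) := by
      rw [count_univ_val_map]
      exact Finset.one_lt_card.mpr ⟨i, by simp, j, by simp [he], hij⟩
    rw [he, ← Multiset.count_pos, Multiset.count_erase_self]
    omega
  · exact (Multiset.mem_erase_of_ne he).mpr (Multiset.mem_map.mpr ⟨j, Finset.mem_univ_val j, rfl⟩)

/-- At an EVEN level `m`, Meyer–Neutsch primitivity `gcd(a₁, …, a₄, m) = 1` of the multiset of values of a Hodge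
character gives `GCD(aᵢ) = 1` in the letter of the named fact (a common divisor `g` of the `aᵢ` divides
`∑ aᵢ = 2m` and is prime to `m`, so `g ∣ 2`, and `g = 2` is not prime to the even `m`).
[cite: MeyerNeutsch1981Fermatquadrupel, (9)–(10) p. 52] -/
theorem forall_dvd_of_isPrimitive_of_even (h2 : 2 ∣ m) {α : Fin 4 → ZMod m} (hα : IsHodge α)
    (hp : IsPrimitive m (univ.val.map α)) : ∀ g : ℕ, (∀ i, g ∣ (α i).val) → g = 1 := by
  intro g hg
  have hm0 : m ≠ 0 := NeZero.ne m
  -- `∑ ⟨aᵢ⟩ = 2m`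
  have hsum : ∑ i, (α i).val = 2 * m := by
    have h1 := hα.2 1
    simp only [Units.val_one, one_mul] at h1
    change 2 * ∑ i, (α i).val = m * 4 at h1
    omega
  have hg4 : g ∣ 2 * m := hsum ▸ Finset.dvd_sum fun i _ ↦ hg i
  -- `gcd(g, m) = 1`
  have hcop : Nat.Coprime g m := by
    have hd : Nat.gcd g m ∣ ((univ.val.map α).map ZMod.val).foldr Nat.gcd m := by
      refine dvd_foldr_gcd₈ (Nat.gcd_dvd_right _ _) fun v hv ↦ ?_
      obtain ⟨a, ha, rfl⟩ := Multiset.mem_map.mp hv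
      obtain ⟨i, -, rfl⟩ := Multiset.mem_map.mp ha
      exact (Nat.gcd_dvd_left _ _).trans (hg i)
    unfold IsPrimitive at hp
    rw [hp] at hd
    exact Nat.dvd_one.mp hd
  have hg2 : g ∣ 2 := hcop.dvd_of_dvd_mul_right hg4
  have hg0 : g ≠ 0 := fun h ↦ by rw [h] at hg2; exact absurd (Nat.eq_zero_of_zero_dvd hg2) two_ne_zero
  have hgle : g ≤ 2 := Nat.le_of_dvd two_pos hg2
  interval_cases g
  · exact absurd rfl hg0
  · rfl
  · exfalso
    have h2' : Nat.gcd 2 m = 2 := Nat.gcd_eq_left h2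
    have h1 := Nat.Coprime.gcd_eq_one hcop
    rw [h2'] at h1
    exact absurd h1 (by norm_num)

/-- **`Δ(m) = 0` for `8 ∣ m`, `3 ∤ m` with a good prime: there is NO exceptional quadruple (Ausnahmequadrupel) at these
levels** — every Hodge `4`-multiset without a pair `a, -a` and with `gcd(a₁, …, a₄, m) = 1` is a unit multiple of `L₁` or
`L₂` ([Aoki1983, Thm. C] at these levels, in the vocabulary of [MeyerNeutsch1981Fermatquadrupel] /
[Shioda1982PicardFermat, Prop. 4]; the kernel sweeps `not_isExceptionalQuadruple_N` are the levels `N ≤ 180` and a few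
others). [cite: Aoki1983, Thm. C] [cite: MeyerNeutsch1981Fermatquadrupel, p. 53 (Standard- und Ausnahmequadrupel)] -/
theorem not_isExceptionalQuadruple_eight_dvd (h8 : 8 ∣ m) (hm3 : ¬ 3 ∣ m) {p : ℕ} (hp : p.Prime) (hpm : p ∣ m)
    (hbig : 11 ≤ p ∨ (5 ≤ p ∧ p ^ 2 ∣ m)) (s : Multiset (ZMod m)) : ¬ IsExceptionalQuadruple m s := by
  rintro ⟨h4, hs, hnp, hprim, hns⟩
  obtain ⟨r, α, rfl⟩ := exists_eq_univ_val_map s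
  have hr : r = 4 := by rw [card_univ_val_map] at h4; exact h4
  subst hr
  have hα : IsHodge α := (isHodge_iff_isHodgeMultiset α).2 hs
  exact hns (isStandardQuadruple_of_eight_dvd h8 hm3 hp hpm hbig hα (indecomposable_of_not_hasPair₈ hnp)
    (forall_dvd_of_isPrimitive_of_even (dvd_trans (by norm_num) h8) hα hprim))

/-- **Aoki–Shioda 1983, Theorem `(𝔅²ₘ)` (ii) at the levels `m` with `8 ∣ m`, `3 ∤ m` and a good prime, in the letter of
the tree's named fact `Literature.AlgebraicGeometry.HodgeTheory.AokiShioda1983_thmB2m_standard`:** every indecomposable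
primitive Hodge character `α` of length `4` and level `m` is, after a permutation of the coordinates,
a) `(i, d + i, −2i, d)` or b) `(i, d + i, d + 2i, −4i)` with `m = 2d`, `1 ≤ i < d`, `(i, d) = 1` (and `3i, 4i, 6i ≠ m`);
alternative c) (`m = 3d`) does not occur. This is the body of that fact at these `m` (for all such `m`, not only
`m > 180`): [Aoki1983, Thm. C] there (`isStandardQuadruple_of_eight_dvd`) and the generic bridge
`letter_of_isStandardQuadruple`. [cite: AokiShioda1983, §2 Theorem (𝔅²ₘ) (ii) a), b), p. 3] [cite: Aoki1983, Thm. C] -/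
theorem thmB2m_standard_eight_dvd (h8 : 8 ∣ m) (hm3 : ¬ 3 ∣ m) {p : ℕ} (hp : p.Prime) (hpm : p ∣ m)
    (hbig : 11 ≤ p ∨ (5 ≤ p ∧ p ^ 2 ∣ m)) (α : Fin 4 → ZMod m) (hα : IsHodge α)
    (hind : ∀ i j : Fin 4, i ≠ j → α i + α j ≠ 0) (hprim : ∀ g : ℕ, (∀ i, g ∣ (α i).val) → g = 1) :
    ∃ σ : Equiv.Perm (Fin 4),
      (∃ d i : ℕ, m = 2 * d ∧ 1 ≤ i ∧ i < d ∧ Nat.Coprime i d ∧ 4 * i ≠ m ∧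
          ∀ k, α (σ k) = ![(i : ZMod m), (d : ZMod m) + i, -(2 * (i : ZMod m)), (d : ZMod m)] k) ∨
      (∃ d i : ℕ, m = 2 * d ∧ 1 ≤ i ∧ i < d ∧ Nat.Coprime i d ∧ 3 * i ≠ m ∧ 4 * i ≠ m ∧ 6 * i ≠ m ∧
          ∀ k, α (σ k) = ![(i : ZMod m), (d : ZMod m) + i, (d : ZMod m) + 2 * i, -(4 * (i : ZMod m))] k) ∨
      (∃ d j : ℕ, m = 3 * d ∧ 1 ≤ j ∧ j < d ∧ Nat.Coprime j d ∧ 6 * j ≠ m ∧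
          ∀ k, α (σ k) = ![(j : ZMod m), (d : ZMod m) + j, 2 * (d : ZMod m) + j, -(3 * (j : ZMod m))] k) :=
  letter_of_isStandardQuadruple hα.1.1 hind (isStandardQuadruple_of_eight_dvd h8 hm3 hp hpm hbig hα hind hprim)

end EightDvd

end Literature.AlgebraicGeometry.Shioda1982
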